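import Summits.BirchSwinnertonDyer.BirchSwinnertonDyer.Theorems.PrintCf2DisegniPairTwoChiLinePointwiseOdd
import HarnessLib

/-!
# Road (C) `disegni-pair-two` on crux stmt-BirchSwinnertonDyer-20368 — the characters of the
# `χ₋₈ ∘ N`-line at `p = 2` (`d* = −2`): `χ₋₈ = χ₈·χ₄`, the line characters `(θχ₋₈)∘N`, the point `θ = χ₈`

Cell `bsd-print-cf2`, width seat `bsd-line-cf2-p1-w8` g21; character bookkeeping for the third member
(`d* = −2`) of the road-(C) trio, used by `…ChiLinePointwiseMinusEight` / `…ChiLineFactorisationMinusEight`.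
THEOREMS ONLY (no `def`, no named fact, no `sorry`); `--supports stmt-BirchSwinnertonDyer-20368`. BSD is not
proved by any of this. `ε₋₂ = χ₋₈ = χ₄χ₈` is Mathlib's `ZMod.χ₈'` (ODD, conductor `8`); on the
Mazur–Tate–Teitelbaum side the odd character `θχ₋₈ = (θχ₈)·ω` (`ω = χ₄`) is read by the odd branch
`L₂⁻(g, α, ω, ·)` at the EVEN character `χ_{θχ₈}` (point `−cycLinePoint ι θ − 2`, `cycLinePoint_mul_chi8`).

* `chi8'_changeLevel_odd`, `chi8'_odd`, `isPrimitive_mul_chi8'_changeLevel` (`θχ₋₈` primitive mod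
  `2^{m+1}`, `m ≥ 3`), `odd_mul_chi8'_changeLevel`;
* `changeLevel_chi8'_eq` (`χ₋₈ = χ₈χ₄` at every level `2^{m+1}`), `mul_chi8_changeLevel_mul_chi4_changeLevel`;
* level `8`: `mul_chi4_changeLevel_eq_chi8'_of_level_eight` (`θχ₄ = χ₋₈` for the even primitive `θ` mod `8`,
  i.e. `θ = χ₈`), `mul_chi8'_changeLevel_eq_chi4_changeLevel_of_level_eight` (`θχ₋₈ = χ₄`),
  `baseChangeDirichlet_chi8'_mul_of_level_eight` (`χ₋₈∘N · θ∘N = χ₄∘N`),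
  `ratMinusTwistedSymbolSum_twin_mul_chi4_of_level_eight`.

References: Montgomery–Vaughan 2007 §9.1 (characters mod `2^k`); Disegni 2017 §1.2; Neukirch ANT VII (6.9);
Mazur–Tate–Teitelbaum 1986 §I.8, §I.13.
-/

set_option autoImplicit false
set_option linter.dupNamespace false

noncomputable section

open scoped Classical MatrixGroups ModularForm NumberField

open CongruenceSubgroup NumberField IsDedekindDomain Literature.NumberTheory.EllipticCurves
  Literature.NumberTheory.EllipticCurves.ModularForms
  Literature.NumberTheory.EllipticCurves.Disegni2017 Literature.NumberTheory.GaloisRepresentations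
  Summit.BirchSwinnertonDyer.Rank1Residual.Additive

namespace Summit.BirchSwinnertonDyer.BirchSwinnertonDyer.Theorems.PrintCf2.DisegniPairTwo

/-! ### §1 The odd character `χ₋₈ = χ₄χ₈` and the line characters `(θχ₋₈)∘N` -/

section MinusEightPoints

/-- `χ₋₈ ⊗ ℂ` is ODD (`χ₋₈(−1) = χ₋₈(7) = −1`) at any level presentation `2^{m+1}`, `8 ∣ 2^{m+1}`.
[cite: MontgomeryVaughan2007, §9.1] -/
theorem chi8'_changeLevel_odd {m : ℕ} (h8 : 8 ∣ 2 ^ (m + 1)) :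
    (DirichletCharacter.changeLevel h8 (ZMod.χ₈'.ringHomComp (Int.castRingHom ℂ))).Odd := by
  have hcop : IsCoprime (-1 : ℤ) ((2 ^ (m + 1) : ℕ) : ℤ) := isCoprime_one_left.neg_left
  rw [DirichletCharacter.Odd, show (-1 : ZMod (2 ^ (m + 1))) = ((-1 : ℤ) : ZMod (2 ^ (m + 1))) by
    rw [Int.cast_neg, Int.cast_one], DirichletCharacter.changeLevel_eq_cast_of_dvd' _ h8 hcop,
    Int.cast_neg, Int.cast_one, MulChar.ringHomComp_apply]
  have h : ZMod.χ₈' (-1 : ZMod 8) = -1 := by decide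
  rw [h, map_neg, map_one]

/-- `χ₋₈ ⊗ ℂ` (level `8 = 2^{2+1}`) is odd. [cite: MontgomeryVaughan2007, §9.1] -/
theorem chi8'_odd :
    DirichletCharacter.Odd (ZMod.χ₈'.ringHomComp (Int.castRingHom ℂ) : DirichletCharacter ℂ (2 ^ (2 + 1))) := by
  show (ZMod.χ₈'.ringHomComp (Int.castRingHom ℂ)) (-1 : ZMod 8) = -1
  rw [MulChar.ringHomComp_apply]
  have h : ZMod.χ₈' (-1 : ZMod 8) = -1 := by decide
  rw [h, map_neg, map_one]

/-- **`θ · χ₋₈` is PRIMITIVE mod `2^{m+1}` for `θ` primitive and `m ≥ 3`** (`χ₋₈` has conductor dividing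
`8 ∣ 2^m`, so it cannot lower the conductor `2^{m+1}` of `θ`; `χ₋₈² = 1`) — twin of
`isPrimitive_mul_chi8_changeLevel`. [cite: MontgomeryVaughan2007, §9.1 (primitive characters)] -/
theorem isPrimitive_mul_chi8'_changeLevel {m : ℕ} (hm : 3 ≤ m) (h8 : 8 ∣ 2 ^ (m + 1))
    {θ : DirichletCharacter ℂ (2 ^ (m + 1))} (hθ : θ.IsPrimitive) :
    (θ * DirichletCharacter.changeLevel h8 (ZMod.χ₈'.ringHomComp (Int.castRingHom ℂ))).IsPrimitive := by
  set ε := DirichletCharacter.changeLevel h8 (ZMod.χ₈'.ringHomComp (Int.castRingHom ℂ)) with hε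
  set ϑ := θ * ε with hϑ
  rw [DirichletCharacter.isPrimitive_def]
  by_contra hne
  have hdvd : ϑ.conductor ∣ 2 ^ (m + 1) := DirichletCharacter.conductor_dvd_level _
  obtain ⟨k, hk, hkeq⟩ := (Nat.dvd_prime_pow Nat.prime_two).mp hdvd
  have hkm : k ≤ m := by
    by_contra hkm
    exact hne (by rw [hkeq, show k = m + 1 by omega])
  have hϑm : ϑ.conductor ∣ 2 ^ m := by rw [hkeq]; exact pow_dvd_pow 2 hkm
  -- `cond ε ∣ 8 ∣ 2^m`
  have h8m : 8 ∣ 2 ^ m := by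
    rw [show (8 : ℕ) = 2 ^ 3 by norm_num]; exact pow_dvd_pow 2 hm
  have hεfac : ε.FactorsThrough 8 :=
    DirichletCharacter.changeLevel_factorsThrough (ZMod.χ₈'.ringHomComp (Int.castRingHom ℂ)) h8
  have hεm : ε.conductor ∣ 2 ^ m :=
    (DirichletCharacter.conductor_dvd_of_mem_conductorSet _ hεfac).trans h8m
  -- `ε² = 1`, so `θ = ϑ ε`
  have hεε : ε * ε = 1 := by
    rw [hε, ← map_mul, ← sq, (ZMod.isQuadratic_χ₈'.comp _).sq_eq_one, map_one]
  have hθeq : θ = ϑ * ε := by rw [hϑ, mul_assoc, hεε, mul_one]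
  have hcond : θ.conductor ∣ 2 ^ m := by
    rw [hθeq]
    exact (DirichletCharacter.conductor_mul_dvd_lcm_conductor ϑ ε).trans (Nat.lcm_dvd hϑm hεm)
  rw [hθ] at hcond
  have := (Nat.pow_dvd_pow_iff_le_right (by norm_num : 1 < 2)).mp hcond
  omega

/-- An even `θ` times `χ₋₈` is ODD. [cite: MontgomeryVaughan2007, §9.1] -/
theorem odd_mul_chi8'_changeLevel {m : ℕ} (h8 : 8 ∣ 2 ^ (m + 1))
    {θ : DirichletCharacter ℂ (2 ^ (m + 1))} (heven : θ.Even) :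
    (θ * DirichletCharacter.changeLevel h8 (ZMod.χ₈'.ringHomComp (Int.castRingHom ℂ))).Odd := by
  rw [DirichletCharacter.Odd, MulChar.coeToFun_mul, Pi.mul_apply, heven, one_mul]
  exact chi8'_changeLevel_odd h8

/-- **`χ₋₈ = χ₈ · χ₄`** at every level `2^{m+1}` divisible by `8` (`ZMod.χ₈'_int_eq_χ₄_mul_χ₈`): the twisting
character of `d* = −2` is the product of those of `d* = 2` and `d* = −1`. [cite: MontgomeryVaughan2007, §9.1] -/
theorem changeLevel_chi8'_eq {m : ℕ} (h8 : 8 ∣ 2 ^ (m + 1)) (h4 : 4 ∣ 2 ^ (m + 1)) :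
    DirichletCharacter.changeLevel h8 (ZMod.χ₈'.ringHomComp (Int.castRingHom ℂ)) =
      DirichletCharacter.changeLevel h8 (ZMod.χ₈.ringHomComp (Int.castRingHom ℂ)) *
        DirichletCharacter.changeLevel h4 (ZMod.χ₄.ringHomComp (Int.castRingHom ℂ)) := by
  refine MulChar.ext fun u ↦ ?_
  rw [MulChar.coeToFun_mul, Pi.mul_apply, DirichletCharacter.changeLevel_eq_cast_of_dvd,
    DirichletCharacter.changeLevel_eq_cast_of_dvd, DirichletCharacter.changeLevel_eq_cast_of_dvd]
  set k : ℕ := (u : ZMod (2 ^ (m + 1))).val with hk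
  have hu : (u : ZMod (2 ^ (m + 1))) = (k : ZMod (2 ^ (m + 1))) := (ZMod.natCast_zmod_val _).symm
  rw [hu, ZMod.cast_natCast h8, ZMod.cast_natCast h4, MulChar.ringHomComp_apply,
    MulChar.ringHomComp_apply, MulChar.ringHomComp_apply]
  have h := ZMod.χ₈'_int_eq_χ₄_mul_χ₈ k
  simp only [Int.cast_natCast] at h
  rw [h, map_mul, mul_comm]

/-- `θ·χ₈·χ₄ = θ·χ₋₈` (level `2^{m+1}`, `8 ∣ 2^{m+1}`). [cite: MontgomeryVaughan2007, §9.1] -/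
theorem mul_chi8_changeLevel_mul_chi4_changeLevel {m : ℕ} (h8 : 8 ∣ 2 ^ (m + 1)) (h4 : 4 ∣ 2 ^ (m + 1))
    (θ : DirichletCharacter ℂ (2 ^ (m + 1))) :
    θ * DirichletCharacter.changeLevel h8 (ZMod.χ₈.ringHomComp (Int.castRingHom ℂ)) *
        DirichletCharacter.changeLevel h4 (ZMod.χ₄.ringHomComp (Int.castRingHom ℂ)) =
      θ * DirichletCharacter.changeLevel h8 (ZMod.χ₈'.ringHomComp (Int.castRingHom ℂ)) := by
  rw [mul_assoc, ← changeLevel_chi8'_eq h8 h4]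

/-- **At level `8`: the even primitive character (`= χ₈`) times `χ₄` is `χ₋₈`.**
[cite: MontgomeryVaughan2007, §9.1] -/
theorem mul_chi4_changeLevel_eq_chi8'_of_level_eight (h4 : 4 ∣ 2 ^ (2 + 1))
    {θ : DirichletCharacter ℂ (2 ^ (2 + 1))} (heven : θ.Even) (hprim : θ.IsPrimitive) :
    θ * DirichletCharacter.changeLevel h4 (ZMod.χ₄.ringHomComp (Int.castRingHom ℂ)) =
      (ZMod.χ₈'.ringHomComp (Int.castRingHom ℂ) : DirichletCharacter ℂ (2 ^ (2 + 1))) := by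
  rw [eq_chi8_of_even_of_isPrimitive θ heven hprim]
  have hall : ∀ x : ZMod (2 ^ (2 + 1)), ZMod.χ₈ x * ZMod.χ₄ (x.cast : ZMod 4) = ZMod.χ₈' x := by decide
  refine MulChar.ext fun u ↦ ?_
  rw [MulChar.coeToFun_mul, Pi.mul_apply, DirichletCharacter.changeLevel_eq_cast_of_dvd,
    MulChar.ringHomComp_apply, MulChar.ringHomComp_apply, MulChar.ringHomComp_apply, ← map_mul, hall]

/-- **At level `8`: the even primitive character (`= χ₈`) times `χ₋₈` is `χ₄`** (`χ₈² = 𝟙`).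
[cite: MontgomeryVaughan2007, §9.1] -/
theorem mul_chi8'_changeLevel_eq_chi4_changeLevel_of_level_eight (h8 : 8 ∣ 2 ^ (2 + 1))
    (h4 : 4 ∣ 2 ^ (2 + 1)) {θ : DirichletCharacter ℂ (2 ^ (2 + 1))} (heven : θ.Even)
    (hprim : θ.IsPrimitive) :
    θ * DirichletCharacter.changeLevel h8 (ZMod.χ₈'.ringHomComp (Int.castRingHom ℂ)) =
      DirichletCharacter.changeLevel h4 (ZMod.χ₄.ringHomComp (Int.castRingHom ℂ)) := by
  rw [eq_chi8_of_even_of_isPrimitive θ heven hprim]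
  have hall : ∀ x : ZMod (2 ^ (2 + 1)),
      ZMod.χ₈ x * ZMod.χ₈' (x.cast : ZMod 8) = ZMod.χ₄ (x.cast : ZMod 4) := by decide
  refine MulChar.ext fun u ↦ ?_
  rw [MulChar.coeToFun_mul, Pi.mul_apply, DirichletCharacter.changeLevel_eq_cast_of_dvd,
    DirichletCharacter.changeLevel_eq_cast_of_dvd, MulChar.ringHomComp_apply, MulChar.ringHomComp_apply,
    MulChar.ringHomComp_apply, ← map_mul, hall]

variable (ι : PadicAlgCl 2 ≃+* ℂ) (K : Type) [Field K] [NumberField K] [IsGalois ℚ K]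

/-- **At the point `θ = χ₈` of the `χ₋₈∘N`-line the line character is `χ₄∘N`**:
`χ₋₈∘N · θ∘N = (θχ₋₈)∘N = χ₄∘N` for the even primitive `θ` mod `8` (`HeckeCharacter.ofDirichlet_mul`,
`ofDirichlet_changeLevel`). [cite: Disegni2017, §1.2 (arXiv v3 PDF p. 6)] [cite: NeukirchANT1999, Ch. VII §6 Prop. (6.9)] -/
theorem baseChangeDirichlet_chi8'_mul_of_level_eight {θ : DirichletCharacter ℂ (2 ^ (2 + 1))}
    (heven : θ.Even) (hprim : θ.IsPrimitive) :
    baseChangeDirichlet K (ZMod.χ₈'.ringHomComp (Int.castRingHom ℂ)) * baseChangeDirichlet K θ =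
      baseChangeDirichlet K (ZMod.χ₄.ringHomComp (Int.castRingHom ℂ)) := by
  have h8 : 8 ∣ 2 ^ (2 + 1) := by norm_num
  have h4 : 4 ∣ 2 ^ (2 + 1) := by norm_num
  rw [baseChangeDirichlet_mul_changeLevel K h8 _ θ,
    mul_chi8'_changeLevel_eq_chi4_changeLevel_of_level_eight h8 h4 heven hprim, baseChangeDirichlet_def,
    baseChangeDirichlet_def, HeckeCharacter.ofDirichlet_changeLevel h4]

/-- **The minus twisted symbol sums of `χ_{θχ₄}` and `χ_{χ₋₈}` agree for the even primitive `θ` mod `8`**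
(`θχ₄ = χ₋₈`; the two sides differ only in the presentation `2^{2+1}` vs `8` of the level).
[cite: MazurTateTeitelbaum1986Invent, §I.8 (8.6)] -/
theorem ratMinusTwistedSymbolSum_twin_mul_chi4_of_level_eight (h4 : 4 ∣ 2 ^ (2 + 1))
    {θ : DirichletCharacter ℂ (2 ^ (2 + 1))} (heven : θ.Even) (hprim : θ.IsPrimitive)
    {N : ℕ} (g : CuspForm (Gamma0 N) 2) :
    ratMinusTwistedSymbolSum g
        (((θ * DirichletCharacter.changeLevel h4 (ZMod.χ₄.ringHomComp (Int.castRingHom ℂ)))⁻¹.ringHomComp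
          ι.symm.toRingHom).ringHomComp (algebraMap (PadicAlgCl 2) ℂ_[2])) =
      ratMinusTwistedSymbolSum g
        (((ZMod.χ₈'.ringHomComp (Int.castRingHom ℂ) : DirichletCharacter ℂ (2 ^ (2 + 1)))⁻¹.ringHomComp
          ι.symm.toRingHom).ringHomComp (algebraMap (PadicAlgCl 2) ℂ_[2])) := by
  rw [mul_chi4_changeLevel_eq_chi8'_of_level_eight h4 heven hprim]

end MinusEightPoints

end Summit.BirchSwinnertonDyer.BirchSwinnertonDyer.Theorems.PrintCf2.DisegniPairTwo

end
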